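import Summits.CriticalPhenomena.CardyFormulaZ2.Theses.CardyUSTContinuation
import Literature.Probability.LatticeModels.FKTwoArcPartitionPolynomials
import Literature.Probability.Percolation.PercolationEvents
import Literature.Probability.Percolation.RussoFormula
import Literature.Probability.Percolation.CardyFormula

/-!
# `BernoulliEndpoint` (support item stmt-CriticalPhenomena-6051, route CardyUSTContinuation)

At `t = 1`, i.e. `p = 1/(1+1) = 1/2` and `q = 1^2 = 1`, the jointly-wired self-dual FK measure
`fkDomainMeasure R.carrier δ (1/(1+1)) (1^2) (R.arc 0 ∪ R.arc 2)` of the discretised conformal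
rectangle `Ω_δ` gives Smirnov's crossing event `discreteCrossing R.carrier δ (R.arc 0) (R.arc 2)`
exactly its probability under Bernoulli bond percolation `P_{1/2}` on `ℤ²`, i.e.
`bondDomainCrossingProb R δ` (Grimmett 2006, §1.3: at `q = 1` the random-cluster measure is
product measure, whatever the wiring).

Proof (finite bookkeeping, both sides computed as finite sums):
* FK side: by `measureReal_fkDomainMeasure_discreteCrossing` at `t = 1` the probability is
  `N_δ(1)/Z_δ(1)`; every configuration `ω ⊆ E(Ω_δ)` has weight `1^{|ω|+2k(ω)} = 1`, so this is
  `#{ω ⊆ E(Ω_δ) | ι(ω) crosses} / 2^{|E(Ω_δ)|}`, `ι = liftConfig` (`Sym2.map Subtype.val`).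
* Percolation side: the crossing event is determined (`DeterminedBy`) by the finite set `K` of
  edges of `ℤ²` underlying `Ω_δ` (the image of `E(Ω_δ)` under `Sym2.map Subtype.val`), so the
  cylinder decomposition `Russo.measureReal_eq_cylPoly` computes its `P_{1/2}`-probability as
  `#{S ⊆ K | S crosses} · (1/2)^{|K|}` (all one-edge weights equal `1/2`).
* `ω ↦ ι(ω)` is a bijection from subsets of `E(Ω_δ)` onto subsets of `K` with `ι(ω) = ↑(ω.image _)`.
-/

noncomputable section

open MeasureTheory Finset
open Literature.Probability.LatticeModels Literature.Probability.Percolation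
open Literature.Probability.RandomPlanarGeometry

namespace Summit.CriticalPhenomena.CardyFormulaZ2.Theorems

/-! ### The edges of `Ω_δ` inside `ℤ²` -/

/-- Configurations agreeing on the edges of `H` have the same open subgraph of `H`:
`openGraph ω ⊓ H = openGraph ω' ⊓ H` whenever `ω ∩ E(H) = ω' ∩ E(H)`. [folklore] -/
theorem openGraph_inf_eq_of_inter_edgeSet_eq {V : Type*} {ω ω' : BondConfig V} {H : SimpleGraph V}
    (h : ω ∩ H.edgeSet = ω' ∩ H.edgeSet) : openGraph ω ⊓ H = openGraph ω' ⊓ H := by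
  ext x y
  simp only [SimpleGraph.inf_adj, openGraph_adj]
  constructor
  · rintro ⟨⟨hm, hne⟩, hadj⟩
    have hmem : s(x, y) ∈ ω' ∩ H.edgeSet := h ▸ ⟨hm, (SimpleGraph.mem_edgeSet H).2 hadj⟩
    exact ⟨⟨hmem.1, hne⟩, hadj⟩
  · rintro ⟨⟨hm, hne⟩, hadj⟩
    have hmem : s(x, y) ∈ ω ∩ H.edgeSet := h.symm ▸ ⟨hm, (SimpleGraph.mem_edgeSet H).2 hadj⟩
    exact ⟨⟨hmem.1, hne⟩, hadj⟩

/-- Smirnov's crossing event only depends on the states of the edges of `Ω_δ`: configurations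
agreeing on `E(discreteDomainGraph Ω δ)` cross together. (Smirnov 2001, §2.) [folklore] -/
theorem mem_discreteCrossing_iff_of_inter_edgeSet_eq {Ω : Set ℂ} {δ : ℝ} {A B : Set ℂ}
    {ω ω' : BondConfig (Site 2)}
    (h : ω ∩ (discreteDomainGraph Ω δ).edgeSet = ω' ∩ (discreteDomainGraph Ω δ).edgeSet) :
    ω ∈ discreteCrossing Ω δ A B ↔ ω' ∈ discreteCrossing Ω δ A B := by
  simp only [mem_discreteCrossing_iff, openGraph_inf_eq_of_inter_edgeSet_eq h]

open scoped Classical in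
/-- The edges of `Ω_δ` inside `ℤ²`: the image of the edge set of the subtype graph
`domainSubgraph Ω δ` under `Sym2.map Subtype.val` is exactly the edge set of
`discreteDomainGraph Ω δ` (every edge of `Ω_δ` has both endpoints in the discrete domain, hence
lifts to the subtype graph). [folklore] -/
theorem coe_image_edgeFinset_domainSubgraph (Ω : Set ℂ) (δ : ℝ) [Fintype (meshDomain Ω δ)] :
    (↑((domainSubgraph Ω δ).edgeFinset.image (Sym2.map Subtype.val)) : Set (Sym2 (Site 2))) =
      (discreteDomainGraph Ω δ).edgeSet := by
  ext e
  simp only [coe_image, SimpleGraph.coe_edgeFinset, Set.mem_image]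
  constructor
  · rintro ⟨e', he', rfl⟩
    induction e' using Sym2.ind with
    | h u v =>
      rw [SimpleGraph.mem_edgeSet, domainSubgraph, SimpleGraph.comap_adj] at he'
      rw [Sym2.map_mk, SimpleGraph.mem_edgeSet]
      exact he'
  · intro he
    induction e using Sym2.ind with
    | h x y =>
      rw [SimpleGraph.mem_edgeSet] at he
      obtain ⟨-, hx, hy⟩ := discreteDomainGraph_adj_iff.1 he
      refine ⟨s(⟨x, hx⟩, ⟨y, hy⟩), ?_, by rw [Sym2.map_mk]⟩
      rw [SimpleGraph.mem_edgeSet, domainSubgraph, SimpleGraph.comap_adj]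
      exact he

open scoped Classical in
/-- The edges of `Ω_δ` are edges of `ℤ²`. [folklore] -/
theorem coe_image_edgeFinset_domainSubgraph_subset (Ω : Set ℂ) (δ : ℝ)
    [Fintype (meshDomain Ω δ)] :
    (↑((domainSubgraph Ω δ).edgeFinset.image (Sym2.map Subtype.val)) : Set (Sym2 (Site 2))) ⊆
      (zdGraph 2).edgeSet := by
  rw [coe_image_edgeFinset_domainSubgraph]
  exact SimpleGraph.edgeSet_mono
    ((discreteDomainGraph_le_meshGraph Ω δ).trans (meshGraph_le_zdGraph Ω δ))

open scoped Classical in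
/-- Smirnov's crossing event is determined by the (finitely many) edges of `Ω_δ`.
(Smirnov 2001, §2; Grimmett 1999, §2.2.) [folklore] -/
theorem determinedBy_discreteCrossing (Ω : Set ℂ) (δ : ℝ) [Fintype (meshDomain Ω δ)]
    (A B : Set ℂ) :
    DeterminedBy (discreteCrossing Ω δ A B)
      (↑((domainSubgraph Ω δ).edgeFinset.image (Sym2.map Subtype.val)) : Set (Sym2 (Site 2))) := by
  rw [determinedBy_iff, coe_image_edgeFinset_domainSubgraph]
  intro ω ω' h
  exact mem_discreteCrossing_iff_of_inter_edgeSet_eq h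

/-! ### The two sides as counts -/

open scoped Classical in
/-- **FK side at `t = 1`.** `φ^{joint}_{Ω_δ, 1/2, 1}(C_δ) = N_δ(1)/Z_δ(1) =
#{ω ⊆ E(Ω_δ) | ι(ω) ∈ C_δ} / 2^{|E(Ω_δ)|}`: at `q = 1`, `p = 1/2` all configurations have the same
weight (Grimmett 2006, §1.3). [folklore] -/
theorem fkDomainMeasure_one_real_discreteCrossing_eq_card_div (R : ConformalRectangle) {δ : ℝ}
    (hδ : 0 < δ) [Fintype (meshDomain R.carrier δ)] :
    (fkDomainMeasure R.carrier δ (1 / (1 + 1)) (1 ^ 2) (R.arc 0 ∪ R.arc 2)).real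
        (discreteCrossing R.carrier δ (R.arc 0) (R.arc 2)) =
      (#((domainSubgraph R.carrier δ).edgeFinset.powerset.filter
          fun ω : Finset (Sym2 (meshDomain R.carrier δ)) =>
            (↑ω : BondConfig (meshDomain R.carrier δ)) ∈ rectCrossing R δ) : ℝ) /
        2 ^ #(domainSubgraph R.carrier δ).edgeFinset := by
  classical
  rw [measureReal_fkDomainMeasure_discreteCrossing R hδ (zero_lt_one' ℝ),
    fkTwoArcCrossingPolynomial_of_pos R hδ, fkTwoArcPartitionPolynomials_of_pos R hδ,
    aeval_rcArcPolynomialIn, aeval_rcArcPolynomial]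
  simp only [one_pow, sum_const, nsmul_eq_mul, mul_one, card_powerset, Nat.cast_pow,
    Nat.cast_ofNat]

open scoped Classical in
/-- **Percolation side.** With `K` the set of edges of `Ω_δ` inside `ℤ²`,
`P_{1/2}(C_δ) = #{S ⊆ K | S ∈ C_δ} · (1/2)^{|K|}`: the crossing event is a union of
`K`-cylinders, each of `P_{1/2}`-probability `(1/2)^{|K|}` (Grimmett 1999, §2.2). [folklore] -/
theorem bondDomainCrossingProb_eq_card_mul (R : ConformalRectangle) (δ : ℝ)
    [Fintype (meshDomain R.carrier δ)] :
    bondDomainCrossingProb R δ =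
      (#(((domainSubgraph R.carrier δ).edgeFinset.image (Sym2.map Subtype.val)).powerset.filter
          fun S : Finset (Sym2 (Site 2)) =>
            (↑S : BondConfig (Site 2)) ∈ discreteCrossing R.carrier δ (R.arc 0) (R.arc 2)) : ℝ) *
        (1 / 2) ^ #((domainSubgraph R.carrier δ).edgeFinset.image (Sym2.map Subtype.val)) := by
  classical
  have hdet := determinedBy_discreteCrossing R.carrier δ (R.arc 0) (R.arc 2)
  have hKE := coe_image_edgeFinset_domainSubgraph_subset R.carrier δ
  rw [bondDomainCrossingProb_eq_measureReal, bondPercolation, Russo.measureReal_eq_cylPoly hdet]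
  simp only [Russo.cylPoly]
  have hw : ∀ S ∈ ((domainSubgraph R.carrier δ).edgeFinset.image (Sym2.map Subtype.val)).powerset,
      (if (↑S : Set (Sym2 (Site 2))) ∈ discreteCrossing R.carrier δ (R.arc 0) (R.arc 2) then
          ∏ i ∈ (domainSubgraph R.carrier δ).edgeFinset.image (Sym2.map Subtype.val),
            Russo.weight (zdGraph 2).edgeSet (↑S) i ((half : unitInterval) : ℝ)
        else 0) =
      if (↑S : Set (Sym2 (Site 2))) ∈ discreteCrossing R.carrier δ (R.arc 0) (R.arc 2) then
        ((1 : ℝ) / 2) ^ #((domainSubgraph R.carrier δ).edgeFinset.image (Sym2.map Subtype.val))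
      else 0 := by
    intro S _
    have hprod : ∏ i ∈ (domainSubgraph R.carrier δ).edgeFinset.image (Sym2.map Subtype.val),
        Russo.weight (zdGraph 2).edgeSet (↑S) i ((half : unitInterval) : ℝ) =
        ((1 : ℝ) / 2) ^ #((domainSubgraph R.carrier δ).edgeFinset.image (Sym2.map Subtype.val)) := by
      rw [← prod_const]
      refine prod_congr rfl fun i hi => ?_
      have hiE : i ∈ (zdGraph 2).edgeSet := hKE (mem_coe.2 hi)
      unfold Russo.weight
      rw [coe_half]
      split_ifs <;> norm_num
    rw [hprod]
  rw [sum_congr rfl hw, ← sum_filter, sum_const, nsmul_eq_mul]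

/-! ### The endpoint identity -/

open scoped Classical in
/-- **FK(`p = 1/2`, `q = 1`) with the two arcs wired jointly gives Smirnov's crossing event its
Bernoulli(`1/2`) bond-percolation probability**, for `δ > 0` and any `Fintype` instance on the
discrete domain. (Grimmett 2006, §1.3: "when `q = 1` this is a product measure"; the wiring only
enters through `q^{k(ω)} = 1`.) [folklore] -/
theorem fkDomainMeasure_one_real_discreteCrossing (R : ConformalRectangle) {δ : ℝ} (hδ : 0 < δ)
    [hfin : Fintype (meshDomain R.carrier δ)] :
    (fkDomainMeasure R.carrier δ (1 / (1 + 1)) (1 ^ 2) (R.arc 0 ∪ R.arc 2)).real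
        (discreteCrossing R.carrier δ (R.arc 0) (R.arc 2)) =
      bondDomainCrossingProb R δ := by
  classical
  have hφ : Function.Injective
      (Sym2.map (Subtype.val : meshDomain R.carrier δ → Site 2)) :=
    Sym2.map.injective Subtype.val_injective
  rw [fkDomainMeasure_one_real_discreteCrossing_eq_card_div R hδ,
    bondDomainCrossingProb_eq_card_mul R δ, card_image_of_injective _ hφ, powerset_image,
    filter_image, card_image_of_injective _ (image_injective hφ), one_div, inv_pow,
    div_eq_mul_inv]
  congr 3
  refine filter_congr fun ω _ => ?_
  rw [coe_mem_rectCrossing_iff, coe_image]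
  rfl

/-- **`BernoulliEndpoint`** (item stmt-CriticalPhenomena-6051 of route CardyUSTContinuation): at
`t = 1` (`p = 1/(1+1) = 1/2`, `q = 1^2 = 1`) the jointly-wired FK crossing probability of `Ω_δ`
IS G02's bond crossing probability `bondDomainCrossingProb R δ`, for every conformal rectangle `R`
and every mesh `δ > 0`. [folklore] -/
theorem bernoulliEndpoint_proof :
    Summit.CriticalPhenomena.CardyFormulaZ2.Theses.CardyUSTContinuation.BernoulliEndpoint := by
  intro R δ h
  exact fkDomainMeasure_one_real_discreteCrossing (hfin := (meshDomain_finite R.isBounded h).fintype)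
    R h

end Summit.CriticalPhenomena.CardyFormulaZ2.Theorems
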